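import Literature.NumberTheory.EllipticCurves.IsogenySelmerGroups
import Literature.NumberTheory.EllipticCurves.SelmerFiniteProofs
import HarnessLib

/-!
# Isogeny Selmer groups under composition: Bhargava–Klagsbrun–Lemke Oliver–Shnidman 2019,
# Lemma 9.1, the bridge `Sel_{[n]} = Sel^{(n)}`, and Bhargava–Elkies–Shnidman Prop. 42 (i)

Cross-ladder literature-typing layer (cell `bsd-littype`, seat 08, gen 6; "typed ≠ proved ≠
endorsed"). Sequel to `IsogenySelmerGroups.lean` (the `φ`-Selmer carrier `Isogeny.selmerGroup`).
Source: Bhargava–Klagsbrun–Lemke Oliver–Shnidman, Duke Math. J. **168** (2019) = arXiv:1709.09790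
(REFEREED), §9 (held text `paper:arxiv-1709.09790`, chunk p0014): **Lemma 9.1** "Let `φ₁ : A₁ → A₂`
and `φ₂ : A₂ → A₃` be isogenies of abelian varieties and set `ψ = φ₂ ∘ φ₁`. Then there is an exact
sequence `Sel_{φ₁}(A₁) → Sel_ψ(A₁) → Sel_{φ₂}(A₂)`", with its proof's display (9.1)
"`0 → A₂(F)[φ₂]/φ₁(A₁(F)[ψ]) → Sel_{φ₁}(A₁) → Sel_ψ(A₁) → Sel_{φ₂}(A₂) → Ш(A₂)[φ₂]/φ₁(Ш(A₁)[ψ]) → 0`";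
and Bhargava–Elkies–Shnidman, J. Lond. Math. Soc. **101** (2020), Prop. 42 (i) (held text
`paper:arxiv-1610.05759`, chunk p0017 L12): "`r(E) ≤ r₃(E) ≤ r_φ(E) + r_{φ̂}(E)`".

## Contents

* §1 The two maps of Lemma 9.1 on the carriers: `Isogeny.galH1KerMapOfLe φ₁ ψ h`
  (`H¹(K, E₁[φ₁]) → H¹(K, E₁[ψ])` along `E₁[φ₁] ⊆ E₁[ψ]`) and `Isogeny.galH1KerMapComp φ₁ φ₂ ψ h`
  (`H¹(K, E₁[ψ]) → H¹(K, E₂[φ₂])` along `φ₁ : E₁[ψ] → E₂[φ₂]`), both Mathlib `ContinuousCohomology.map`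
  along `id : Γ_K → Γ_K` (pattern of the tree's `torsionH1ToH1`).
* §2 The named fact `BhargavaKlagsbrunLemkeOliverShnidman2019.lemma91_selmerGroup_exact` (REFEREED;
  elliptic curves — printed for abelian varieties, `TODO(general form)`): the two maps carry Selmer
  groups to Selmer groups, the sequence is exact at `Sel_ψ(E₁)`, and (display (9.1)) the kernel of
  `Sel_{φ₁}(E₁) → Sel_ψ(E₁)` is finite of order at most `#E₂(F)[φ₂]`.
* §3 PROVED, the bridge to the tree's `n`-Selmer group: for an isogeny `ψ : E → E` acting as `[n]`
  on `E(K̄)` (e.g. `ψ = φ̂ ∘ φ`, `n = deg φ`), `Sel_ψ(E/K) ≃+ Sel^{(n)}(E/K)`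
  (`Isogeny.nonempty_selmerGroup_addEquiv_selmerGroup`): the two carriers are the SAME subgroup
  `E[n]` of `E(K̄)` with the same `Γ_K`-action, seen through two coefficient types (`ker ψ` vs
  `torsionBy`); the identification is transport along the equality of subgroups (generic
  `subgroupSelmerGroup`, `subgroupSelmerGroup_congr`), no cohomological input.
* §4 PROVED consequences of §2: the cardinality inequality `#Sel_ψ(E₁) ≤ #Sel_{φ₁}(E₁) · #Sel_{φ₂}(E₂)`
  (`natCard_selmerGroup_le_mul_of_lemma91`); BES Prop. 42 (i) in the tree's currency,
  `#Sel^{(3)}(E/K) ≤ #Sel_φ(E) · #Sel_{φ̂}(E')` for a dual pair of `3`-isogenies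
  (`natCard_selmerGroup_three_le_of_lemma91`); and finiteness of EVERY isogeny Selmer group of an
  elliptic curve over a number field (`finite_selmerGroup_of_lemma91`: `Sel_φ(E) → Sel_{φ̂∘φ}(E) ≅
  Sel^{(n)}(E)` has finite kernel by (9.1) and finite target by the tree's THEOREM
  `finite_selmerGroup_holds`, Silverman X.4.2 (b)).

## Not done here

The full five-term sequence (9.1) (its Ш-terms need `Ш(E)[φ]` for an isogeny); the §9.1 convexity
step and Thm. 2.5 (a) in Selmer form (`OPEN-QUESTIONS-08.md` §I BKLOS-Q4: with this file the only
missing input is "`#Sel_φ(E)` is a power of `deg φ = 3`", i.e. `3 · H¹(K, E[φ]) = 0`).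

## References

* [BhargavaKlagsbrunLemkeOliverShnidman2019] Duke Math. J. 168 (2019), §9 Lemma 9.1 and display
  (9.1) (chunk p0014 L5–L16).
* [BhargavaElkiesShnidman2019] J. Lond. Math. Soc. (2) 101 (2020) 299–327, Prop. 42 (i) and display
  (8.1) (chunk p0017 L9–L21).
* [SilvermanAEC2009] J. H. Silverman, *The Arithmetic of Elliptic Curves*, 2nd ed., X.§4
  (Thm. X.4.2 (b)), III.§6 (dual isogeny, Thm. III.6.1–6.2).
-/

noncomputable section

open scoped Classical NumberField
open Filter Topology
open WeierstrassCurve IsDedekindDomain NumberField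

universe u

namespace WeierstrassCurve

open Literature.NumberTheory.EllipticCurves

variable {K : Type u} [Field K]

/-! ## §3 (first, as it is vocabulary) The generic Selmer group of a `Γ_K`-stable subgroup of `E(K̄)`
and the bridge `Sel_{[n]} = Sel^{(n)}` -/

section Generic

variable (W : WeierstrassCurve K)

/-- The `Γ_K`-action of `E(K̄)` restricted to a `Γ_K`-stable subgroup `S` (generic form of the tree's
`AddSubgroup.torsionBy.instDistribMulAction` and of `Isogeny.kerAction`; an `abbrev`, not an
instance). Silverman, *AEC*, III.§7 / X.§4. [cite: SilvermanAEC2009, X.§4 (Thm. X.4.2, the G-module E[φ])] -/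
abbrev restrictedAction (S : AddSubgroup W.geomPoints)
    (hS : ∀ (σ : Field.absoluteGaloisGroup K) {P : W.geomPoints}, P ∈ S → σ • P ∈ S) :
    DistribMulAction (Field.absoluteGaloisGroup K) S where
  smul σ P := ⟨σ • (P : W.geomPoints), hS σ P.2⟩
  one_smul P := Subtype.ext (one_smul (Field.absoluteGaloisGroup K) (P : W.geomPoints))
  mul_smul σ τ P := Subtype.ext (mul_smul σ τ (P : W.geomPoints))
  smul_zero σ := Subtype.ext (smul_zero σ)
  smul_add σ P Q := Subtype.ext (smul_add σ (P : W.geomPoints) Q)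

variable [NumberField K]

/-- The Selmer group cut out in `H¹(K, S)` by the local conditions "dies in `H¹(K_v, E)` at every
place", for a `Γ_K`-stable subgroup `S ⊆ E(K̄)` — the common shape of the tree's
`WeierstrassCurve.selmerGroup n` (`S = E[n]`) and of `Isogeny.selmerGroup φ` (`S = E[φ]`).
Silverman, *AEC*, X.§4. [cite: SilvermanAEC2009, X.§4 (Thm. X.4.2)] -/
def subgroupSelmerGroup (S : AddSubgroup W.geomPoints)
    (hS : ∀ (σ : Field.absoluteGaloisGroup K) {P : W.geomPoints}, P ∈ S → σ • P ∈ S) :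
    AddSubgroup (letI := W.restrictedAction S hS
      discreteH1 (Field.absoluteGaloisGroup K) S) :=
  letI := W.restrictedAction S hS
  (⨅ v : HeightOneSpectrum (𝓞 K),
      resKer (resGal (K := K) (v.adicCompletion K)) ((pointsMap W (v.adicCompletion K)).comp S.subtype)
        fun σ P ↦ pointsMap_smul W (v.adicCompletion K) σ (P : W.geomPoints)) ⊓
    ⨅ w : InfinitePlace K,
      resKer (resGal (K := K) w.Completion) ((pointsMap W w.Completion).comp S.subtype)
        fun σ P ↦ pointsMap_smul W w.Completion σ (P : W.geomPoints)

/-- **Transport**: equal stable subgroups of `E(K̄)` have isomorphic (indeed identical) Selmer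
groups. [cite: SilvermanAEC2009, X.§4 (Thm. X.4.2)] -/
theorem subgroupSelmerGroup_congr {S₁ S₂ : AddSubgroup W.geomPoints} (h : S₁ = S₂)
    (hS₁ : ∀ (σ : Field.absoluteGaloisGroup K) {P : W.geomPoints}, P ∈ S₁ → σ • P ∈ S₁)
    (hS₂ : ∀ (σ : Field.absoluteGaloisGroup K) {P : W.geomPoints}, P ∈ S₂ → σ • P ∈ S₂) :
    Nonempty (W.subgroupSelmerGroup S₁ hS₁ ≃+ W.subgroupSelmerGroup S₂ hS₂) := by
  subst h
  exact ⟨AddEquiv.refl _⟩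

/-- The tree's `n`-Selmer group `Sel^{(n)}(E/K)` IS the generic Selmer group of `S = E[n]`
(definitionally: same carrier `E[n] = torsionBy`, same restricted action, same local kernels).
[cite: SilvermanAEC2009, X.§4 (Thm. X.4.2)] -/
theorem nonempty_selmerGroup_addEquiv_subgroupSelmerGroup (n : ℤ) :
    Nonempty (W.selmerGroup n ≃+
      W.subgroupSelmerGroup (W.geomTorsion n) fun σ _ hP ↦ smul_mem_torsionBy σ hP) :=
  ⟨AddEquiv.refl _⟩

end Generic

namespace Isogeny

variable {W W' : WeierstrassCurve K}

/-- `Sel_φ(E/K)` IS the generic Selmer group of `S = E[φ] = ker φ` (definitionally).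
[cite: BhargavaKlagsbrunLemkeOliverShnidman2019, §7 (chunk p0011 L3–L9)] -/
theorem nonempty_selmerGroup_addEquiv_subgroupSelmerGroup [NumberField K] (φ : Isogeny W W') :
    Nonempty (φ.selmerGroup ≃+
      W.subgroupSelmerGroup φ.toAddMonoidHom.ker fun σ _ hP ↦ φ.smul_mem_ker σ hP) :=
  ⟨AddEquiv.refl _⟩

/-- An isogeny `ψ : E → E` acting as `[n]` on `E(K̄)` has kernel `E[n]`.
[cite: SilvermanAEC2009, III.§6 (Thm. III.6.1: φ̂ ∘ φ = [m])] -/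
theorem ker_eq_geomTorsion_of_forall_eq_zsmul (ψ : Isogeny W W) {n : ℤ}
    (h : ∀ P, ψ P = n • P) : ψ.toAddMonoidHom.ker = W.geomTorsion n := by
  ext P
  rw [AddMonoidHom.mem_ker, coe_toAddMonoidHom, h]
  exact (Submodule.mem_torsionBy_iff (R := ℤ) n P).symm.trans Iff.rfl

/-- **The bridge `Sel_{[n]}(E/K) ≃ Sel^{(n)}(E/K)`**: for an isogeny `ψ : E → E` with `ψ = [n]` on
`E(K̄)` — e.g. `ψ = φ̂ ∘ φ` with `n = deg φ` (Silverman *AEC* III.6.1), the tree's `Isogeny.comp` —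
the `ψ`-Selmer group of `IsogenySelmerGroups.lean` and the tree's `n`-Selmer group
`WeierstrassCurve.selmerGroup n` are isomorphic: both are `ker (H¹(K, E[n]) → ∏_v H¹(K_v, E))`
(transport along `ker ψ = E[n]`; no cohomological input). This is the identification under which
BKLOS Lemma 9.1 at `ψ = [3]` speaks about `Sel₃(E)`.
[cite: BhargavaKlagsbrunLemkeOliverShnidman2019, §9.1 (chunk p0014 L33–L39, Sel₃ via Sel_φ and Sel_φ̂)] -/
theorem nonempty_selmerGroup_addEquiv_selmerGroup [NumberField K] (ψ : Isogeny W W) {n : ℤ}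
    (h : ∀ P, ψ P = n • P) : Nonempty (ψ.selmerGroup ≃+ W.selmerGroup n) := by
  obtain ⟨e₁⟩ := ψ.nonempty_selmerGroup_addEquiv_subgroupSelmerGroup
  obtain ⟨e₂⟩ := W.subgroupSelmerGroup_congr (ψ.ker_eq_geomTorsion_of_forall_eq_zsmul h)
    (fun σ _ hP ↦ ψ.smul_mem_ker σ hP) (fun σ _ hP ↦ smul_mem_torsionBy σ hP)
  obtain ⟨e₃⟩ := W.nonempty_selmerGroup_addEquiv_subgroupSelmerGroup n
  exact ⟨e₁.trans (e₂.trans e₃.symm)⟩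

/-- `#Sel_{[n]}(E/K) = #Sel^{(n)}(E/K)` (from the bridge). [cite: SilvermanAEC2009, X.§4 (Thm. X.4.2)] -/
theorem natCard_selmerGroup_eq_of_forall_eq_zsmul [NumberField K] (ψ : Isogeny W W) {n : ℤ}
    (h : ∀ P, ψ P = n • P) : Nat.card ψ.selmerGroup = Nat.card (W.selmerGroup n) := by
  obtain ⟨e⟩ := ψ.nonempty_selmerGroup_addEquiv_selmerGroup h
  exact Nat.card_congr e.toEquiv

/-- `Sel_{[n]}(E/K)` is finite for `E` elliptic and `n ≠ 0` (the bridge + the tree's THEOREM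
`finite_selmerGroup_holds`, Silverman X.4.2 (b)). [cite: SilvermanAEC2009, X.§4 (Thm. X.4.2 (b))] -/
theorem finite_selmerGroup_of_forall_eq_zsmul [NumberField K] [W.IsElliptic] (ψ : Isogeny W W)
    {n : ℤ} (hn : n ≠ 0) (h : ∀ P, ψ P = n • P) : Finite ψ.selmerGroup := by
  obtain ⟨e⟩ := ψ.nonempty_selmerGroup_addEquiv_selmerGroup h
  haveI : Finite (W.selmerGroup n) := W.finite_selmerGroup_holds hn
  exact Finite.of_equiv _ e.toEquiv.symm

/-! ## §1 The two maps of Lemma 9.1 -/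

variable {W₁ W₂ W₃ : WeierstrassCurve K}

/-- The kernel-level map `φ₁ : E₁[ψ] → E₂[φ₂]` for `ψ = φ₂ ∘ φ₁` (`φ₂(φ₁ P) = ψ P = O`).
[cite: BhargavaKlagsbrunLemkeOliverShnidman2019, Lemma 9.1 (chunk p0014 L5–L10)] -/
def kerMapComp (φ₁ : Isogeny W₁ W₂) (φ₂ : Isogeny W₂ W₃) (ψ : Isogeny W₁ W₃)
    (h : ∀ P, φ₂ (φ₁ P) = ψ P) : ψ.toAddMonoidHom.ker →+ φ₂.toAddMonoidHom.ker :=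
  (φ₁.toAddMonoidHom.comp ψ.toAddMonoidHom.ker.subtype).codRestrict φ₂.toAddMonoidHom.ker fun P ↦ by
    rw [AddMonoidHom.mem_ker, AddMonoidHom.coe_comp, AddSubgroup.coe_subtype, Function.comp_apply,
      coe_toAddMonoidHom, coe_toAddMonoidHom, h]
    exact (AddMonoidHom.mem_ker).mp (by simpa only [coe_toAddMonoidHom] using P.2)

/-- `ker φ₁ ≤ ker ψ` for `ψ = φ₂ ∘ φ₁`. [cite: BhargavaKlagsbrunLemkeOliverShnidman2019, Lemma 9.1 (chunk p0014 L5–L10)] -/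
theorem ker_le_ker_of_comp (φ₁ : Isogeny W₁ W₂) (φ₂ : Isogeny W₂ W₃) (ψ : Isogeny W₁ W₃)
    (h : ∀ P, φ₂ (φ₁ P) = ψ P) : φ₁.toAddMonoidHom.ker ≤ ψ.toAddMonoidHom.ker := by
  intro P hP
  rw [AddMonoidHom.mem_ker, coe_toAddMonoidHom] at hP ⊢
  rw [← h, hP, map_zero]

/-- **`H¹(K, E₁[φ₁]) → H¹(K, E₁[ψ])`** induced by an inclusion of kernels `E₁[φ₁] ⊆ E₁[ψ]` (the first
map of Lemma 9.1 for `ψ = φ₂ ∘ φ₁`); Mathlib's `ContinuousCohomology.map` along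
`(id : Γ_K → Γ_K, E₁[φ₁] ↪ E₁[ψ])`, as the tree's `torsionH1ToH1`.
[cite: BhargavaKlagsbrunLemkeOliverShnidman2019, Lemma 9.1 (chunk p0014 L5–L10)] -/
def galH1KerMapOfLe (φ₁ : Isogeny W₁ W₂) (ψ : Isogeny W₁ W₃)
    (hle : φ₁.toAddMonoidHom.ker ≤ ψ.toAddMonoidHom.ker) : φ₁.galH1Ker →+ ψ.galH1Ker :=
  letI := φ₁.kerAction
  letI := ψ.kerAction
  (ContinuousCohomology.map (ContinuousMonoidHom.id (Field.absoluteGaloisGroup K))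
    (resHomOfEquivariant (ContinuousMonoidHom.id (Field.absoluteGaloisGroup K))
      (AddSubgroup.inclusion hle) (fun _ _ ↦ rfl)) 1).hom.toLinearMap.toAddMonoidHom

/-- **`H¹(K, E₁[ψ]) → H¹(K, E₂[φ₂])`** induced by `φ₁ : E₁[ψ] → E₂[φ₂]` (the second map of Lemma 9.1
for `ψ = φ₂ ∘ φ₁`); `ContinuousCohomology.map` along `(id, kerMapComp)` (equivariance: `φ₁` is
defined over `K`). [cite: BhargavaKlagsbrunLemkeOliverShnidman2019, Lemma 9.1 (chunk p0014 L5–L10)] -/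
def galH1KerMapComp (φ₁ : Isogeny W₁ W₂) (φ₂ : Isogeny W₂ W₃) (ψ : Isogeny W₁ W₃)
    (h : ∀ P, φ₂ (φ₁ P) = ψ P) : ψ.galH1Ker →+ φ₂.galH1Ker :=
  letI := ψ.kerAction
  letI := φ₂.kerAction
  (ContinuousCohomology.map (ContinuousMonoidHom.id (Field.absoluteGaloisGroup K))
    (resHomOfEquivariant (ContinuousMonoidHom.id (Field.absoluteGaloisGroup K))
      (kerMapComp φ₁ φ₂ ψ h) (fun σ P ↦ Subtype.ext (φ₁.map_smul σ (P : W₁.geomPoints)))) 1)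
    |>.hom.toLinearMap.toAddMonoidHom

end Isogeny

end WeierstrassCurve

/-! ## §2 Lemma 9.1 (named fact, REFEREED) -/

namespace Literature.NumberTheory.EllipticCurves

namespace BhargavaKlagsbrunLemkeOliverShnidman2019

open WeierstrassCurve WeierstrassCurve.Isogeny

/-- **Bhargava–Klagsbrun–Lemke Oliver–Shnidman 2019, Lemma 9.1** (Duke Math. J. 168): "Let
`φ₁ : A₁ → A₂` and `φ₂ : A₂ → A₃` be isogenies of abelian varieties and set `ψ = φ₂ ∘ φ₁`. Then there
is an exact sequence `Sel_{φ₁}(A₁) → Sel_ψ(A₁) → Sel_{φ₂}(A₂)`. *Proof.* In fact, a standard diagram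
chase yields the exact sequence (9.1)
`0 → A₂(F)[φ₂]/φ₁(A₁(F)[ψ]) → Sel_{φ₁}(A₁) → Sel_ψ(A₁) → Sel_{φ₂}(A₂) → Ш(A₂)[φ₂]/φ₁(Ш(A₁)[ψ]) → 0`."
Transcription, for ELLIPTIC CURVES over a number field `K` (`TODO(general form)`: abelian
varieties): `φ₁ : Isogeny W₁ W₂`, `φ₂ : Isogeny W₂ W₃`, `ψ : Isogeny W₁ W₃` with `φ₂ (φ₁ P) = ψ P` on
`E₁(K̄)` (e.g. `ψ = φ₂.comp φ₁`); the maps are `ι = galH1KerMapOfLe φ₁ ψ` (along `E₁[φ₁] ⊆ E₁[ψ]`)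
and `π = galH1KerMapComp φ₁ φ₂ ψ` (along `φ₁ : E₁[ψ] → E₂[φ₂]`). Clauses: (a) `ι(Sel_{φ₁}(E₁)) ⊆
Sel_ψ(E₁)`; (b) `π(Sel_ψ(E₁)) ⊆ Sel_{φ₂}(E₂)`; (c) exactness at `Sel_ψ(E₁)`: a Selmer class dies under
`π` iff it comes from `Sel_{φ₁}(E₁)`; (d) (first term of (9.1)) the kernel of `ι` on `Sel_{φ₁}(E₁)` is
finite of order at most `#E₂(F)[φ₂]` (`Isogeny.ratKerCard φ₂`; the print gives the exact order
`#(E₂(F)[φ₂]/φ₁(E₁(F)[ψ]))` — clause (d) is the weaker bound). REFEREED; no `_holds` expected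
(long exact cohomology sequences of `0 → E₁[φ₁] → E₁[ψ] → E₂[φ₂] → 0` over `K` and all `K_v`).
[cite: BhargavaKlagsbrunLemkeOliverShnidman2019, Lemma 9.1 with display (9.1) (chunk p0014 L5–L16)] -/
def lemma91_selmerGroup_exact : Prop :=
  ∀ (K : Type) [Field K] [NumberField K] (W₁ W₂ W₃ : WeierstrassCurve K) [W₁.IsElliptic]
    [W₂.IsElliptic] [W₃.IsElliptic] (φ₁ : Isogeny W₁ W₂) (φ₂ : Isogeny W₂ W₃) (ψ : Isogeny W₁ W₃)
    (h : ∀ P, φ₂ (φ₁ P) = ψ P),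
    (φ₁.selmerGroup.map (galH1KerMapOfLe φ₁ ψ (ker_le_ker_of_comp φ₁ φ₂ ψ h)) ≤ ψ.selmerGroup) ∧
    (ψ.selmerGroup.map (galH1KerMapComp φ₁ φ₂ ψ h) ≤ φ₂.selmerGroup) ∧
    (∀ c ∈ ψ.selmerGroup, galH1KerMapComp φ₁ φ₂ ψ h c = 0 ↔
      c ∈ φ₁.selmerGroup.map (galH1KerMapOfLe φ₁ ψ (ker_le_ker_of_comp φ₁ φ₂ ψ h))) ∧
    ({c : φ₁.galH1Ker | c ∈ φ₁.selmerGroup ∧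
        galH1KerMapOfLe φ₁ ψ (ker_le_ker_of_comp φ₁ φ₂ ψ h) c = 0}.Finite ∧
      {c : φ₁.galH1Ker | c ∈ φ₁.selmerGroup ∧
        galH1KerMapOfLe φ₁ ψ (ker_le_ker_of_comp φ₁ φ₂ ψ h) c = 0}.ncard ≤ φ₂.ratKerCard)

/-! ## §4 Proved consequences -/

/-- **`#Sel_ψ(E₁) ≤ #Sel_{φ₁}(E₁) · #Sel_{φ₂}(E₂)`** for `ψ = φ₂ ∘ φ₁` with `Sel_{φ₁}`, `Sel_{φ₂}` finite
(from Lemma 9.1 (a)–(c): restricted to `Sel_ψ(E₁)`, the map `π` has kernel `ι(Sel_{φ₁}(E₁))` and image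
inside `Sel_{φ₂}(E₂)`; `#G = #(G/ker) · #ker`). This is how BKLOS §9 ("Proof of Theorem (ab var
ranks)") and BES Prop. 42 (i) use the lemma. [cite: BhargavaKlagsbrunLemkeOliverShnidman2019, §9 (chunk p0014 L18–L27, "by Lemma (lem:ranks-add)")] -/
theorem natCard_selmerGroup_le_mul_of_lemma91 (h91 : lemma91_selmerGroup_exact) {K : Type}
    [Field K] [NumberField K] {W₁ W₂ W₃ : WeierstrassCurve K} [W₁.IsElliptic] [W₂.IsElliptic]
    [W₃.IsElliptic] (φ₁ : Isogeny W₁ W₂) (φ₂ : Isogeny W₂ W₃) (ψ : Isogeny W₁ W₃)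
    (h : ∀ P, φ₂ (φ₁ P) = ψ P) [Finite φ₁.selmerGroup] [Finite φ₂.selmerGroup] :
    Nat.card ψ.selmerGroup ≤ Nat.card φ₁.selmerGroup * Nat.card φ₂.selmerGroup := by
  obtain ⟨-, hb, hc, -⟩ := h91 K W₁ W₂ W₃ φ₁ φ₂ ψ h
  set ι := galH1KerMapOfLe φ₁ ψ (ker_le_ker_of_comp φ₁ φ₂ ψ h) with hι
  set π := galH1KerMapComp φ₁ φ₂ ψ h with hπ
  -- `π` restricted to `Sel_ψ(E₁)`, landing in `Sel_{φ₂}(E₂)`.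
  let g : ψ.selmerGroup →+ φ₂.selmerGroup :=
    (π.comp ψ.selmerGroup.subtype).codRestrict φ₂.selmerGroup fun c ↦ hb ⟨c, c.2, rfl⟩
  -- `#Sel_ψ = #(range g) · #(ker g)`.
  have hcard : Nat.card ψ.selmerGroup = Nat.card g.range * Nat.card g.ker := by
    rw [AddSubgroup.card_eq_card_quotient_mul_card_addSubgroup g.ker,
      Nat.card_congr (QuotientAddGroup.quotientKerEquivRange g).toEquiv]
  -- `#(range g) ≤ #Sel_{φ₂}`.
  have hrange : Nat.card g.range ≤ Nat.card φ₂.selmerGroup :=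
    Nat.card_le_card_of_injective _ g.range.subtype_injective
  -- `ker g ↪ ι(Sel_{φ₁})`, and `#ι(Sel_{φ₁}) ≤ #Sel_{φ₁}`.
  have hker : Nat.card g.ker ≤ Nat.card φ₁.selmerGroup := by
    have hsub : ∀ c : g.ker, ((c : ψ.selmerGroup) : ψ.galH1Ker) ∈ φ₁.selmerGroup.map ι := by
      intro c
      have hc0 : π ((c : ψ.selmerGroup) : ψ.galH1Ker) = 0 := by
        have := c.2
        rw [AddMonoidHom.mem_ker] at this
        exact congrArg Subtype.val this
      exact (hc _ (c : ψ.selmerGroup).2).mp hc0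
    haveI : Finite (φ₁.selmerGroup.map ι) :=
      Finite.of_surjective (fun s : φ₁.selmerGroup ↦ (⟨ι s, ⟨s, s.2, rfl⟩⟩ : φ₁.selmerGroup.map ι))
        (by rintro ⟨_, s, hs, rfl⟩; exact ⟨⟨s, hs⟩, rfl⟩)
    calc Nat.card g.ker ≤ Nat.card (φ₁.selmerGroup.map ι) :=
          Nat.card_le_card_of_injective (fun c ↦ (⟨_, hsub c⟩ : φ₁.selmerGroup.map ι))
            (fun c d hcd ↦ Subtype.ext (Subtype.ext (by simpa using Subtype.ext_iff.mp hcd)))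
      _ ≤ Nat.card φ₁.selmerGroup :=
          Nat.card_le_card_of_surjective
            (fun s : φ₁.selmerGroup ↦ (⟨ι s, ⟨s, s.2, rfl⟩⟩ : φ₁.selmerGroup.map ι))
            (by rintro ⟨_, s, hs, rfl⟩; exact ⟨⟨s, hs⟩, rfl⟩)
  calc Nat.card ψ.selmerGroup = Nat.card g.range * Nat.card g.ker := hcard
    _ ≤ Nat.card φ₂.selmerGroup * Nat.card φ₁.selmerGroup := Nat.mul_le_mul hrange hker
    _ = Nat.card φ₁.selmerGroup * Nat.card φ₂.selmerGroup := Nat.mul_comm _ _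

/-- **Finiteness of every isogeny Selmer group** of an elliptic curve over a number field, from
Lemma 9.1 (d) and the tree's theorem `finite_selmerGroup_holds` (Silverman X.4.2 (b)): for
`φ : E → E'` with `ψ ∘ φ = [n]` (`ψ` the dual isogeny, `n = deg φ`), `Sel_φ(E) → Sel_{ψ∘φ}(E) ≅
Sel^{(n)}(E)` has finite kernel (`≤ #E'(F)[ψ]`) and finite target.
[cite: SilvermanAEC2009, X.§4 (Thm. X.4.2 (b))] -/
theorem finite_selmerGroup_of_lemma91 (h91 : lemma91_selmerGroup_exact) {K : Type} [Field K]
    [NumberField K] {W W' : WeierstrassCurve K} [W.IsElliptic] [W'.IsElliptic] (φ : Isogeny W W')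
    (ψ : Isogeny W' W) {n : ℤ} (hn : n ≠ 0) (hdual : ∀ P, ψ (φ P) = n • P) :
    Finite φ.selmerGroup := by
  -- the composite `ψ ∘ φ = [n]` as an isogeny `E → E`
  have hcomp : ∀ P, ψ (φ P) = ψ.comp φ P := fun P ↦ (comp_apply ψ φ P).symm
  obtain ⟨ha, -, -, hfin, -⟩ := h91 K W W' W φ ψ (ψ.comp φ) hcomp
  haveI : Finite (ψ.comp φ).selmerGroup :=
    (ψ.comp φ).finite_selmerGroup_of_forall_eq_zsmul hn fun P ↦ by rw [comp_apply, hdual]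
  set ι := galH1KerMapOfLe φ (ψ.comp φ) (ker_le_ker_of_comp φ ψ (ψ.comp φ) hcomp)
  -- `ι` restricted to `Sel_φ(E)`, landing in the finite group `Sel_{ψ∘φ}(E)`.
  let g : φ.selmerGroup →+ (ψ.comp φ).selmerGroup :=
    (ι.comp φ.selmerGroup.subtype).codRestrict (ψ.comp φ).selmerGroup fun c ↦ ha ⟨c, c.2, rfl⟩
  haveI : Finite g.range := inferInstance
  haveI : Finite g.ker := by
    have e : g.ker ≃ {c : φ.galH1Ker | c ∈ φ.selmerGroup ∧ ι c = 0} :=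
      { toFun := fun c ↦ ⟨(c : φ.selmerGroup), (c : φ.selmerGroup).2, by
          have := c.2; rw [AddMonoidHom.mem_ker] at this; exact congrArg Subtype.val this⟩
        invFun := fun c ↦ ⟨⟨c.1, c.2.1⟩, by
          rw [AddMonoidHom.mem_ker]; exact Subtype.ext c.2.2⟩
        left_inv := fun c ↦ rfl
        right_inv := fun c ↦ rfl }
    haveI : Finite {c : φ.galH1Ker | c ∈ φ.selmerGroup ∧ ι c = 0} := hfin.to_subtype
    exact Finite.of_equiv _ e.symm
  have hcard : Nat.card φ.selmerGroup = Nat.card g.range * Nat.card g.ker := by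
    rw [AddSubgroup.card_eq_card_quotient_mul_card_addSubgroup g.ker,
      Nat.card_congr (QuotientAddGroup.quotientKerEquivRange g).toEquiv]
  have hpos : 0 < Nat.card φ.selmerGroup := by
    rw [hcard]; exact Nat.mul_pos Nat.card_pos Nat.card_pos
  exact Nat.finite_of_card_ne_zero hpos.ne'

/-- **Bhargava–Elkies–Shnidman 2020, Prop. 42 (i), second inequality, in the tree's currency**:
"`r₃(E) ≤ r_φ(E) + r_{φ̂}(E)`" — `#Sel^{(3)}(E/K) ≤ #Sel_φ(E) · #Sel_{φ̂}(E')` for a `3`-isogeny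
`φ : E → E'` with dual `φ̂` (`φ̂ ∘ φ = [3]`), from Lemma 9.1 at `ψ = φ̂ ∘ φ` (BES: "follows from the
exact sequence (8.1)") and the bridge `Sel_{[3]}(E) ≅ Sel^{(3)}(E)`. The Selmer groups are finite
(`finite_selmerGroup_of_lemma91`; for `Sel_{φ̂}(E')` via `φ ∘ φ̂ = [3]` on `E'`, Silverman III.6.2).
[cite: BhargavaElkiesShnidman2019, Prop. 42 (i) (chunk p0017 L12, L17–L21)]
[cite: BhargavaKlagsbrunLemkeOliverShnidman2019, Lemma 9.1 (chunk p0014 L5–L16)] -/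
theorem natCard_selmerGroup_three_le_of_lemma91 (h91 : lemma91_selmerGroup_exact) {K : Type}
    [Field K] [NumberField K] {W W' : WeierstrassCurve K} [W.IsElliptic] [W'.IsElliptic]
    (φ : Isogeny W W') (ψ : Isogeny W' W) (hψφ : ∀ P, ψ (φ P) = (3 : ℤ) • P)
    (hφψ : ∀ Q, φ (ψ Q) = (3 : ℤ) • Q) :
    Nat.card (W.selmerGroup 3) ≤ Nat.card φ.selmerGroup * Nat.card ψ.selmerGroup := by
  haveI := finite_selmerGroup_of_lemma91 h91 φ ψ (by norm_num) hψφ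
  haveI := finite_selmerGroup_of_lemma91 h91 ψ φ (by norm_num) hφψ
  have hcomp : ∀ P, ψ (φ P) = ψ.comp φ P := fun P ↦ (comp_apply ψ φ P).symm
  rw [← (ψ.comp φ).natCard_selmerGroup_eq_of_forall_eq_zsmul (n := 3)
    (fun P ↦ by rw [comp_apply, hψφ])]
  exact natCard_selmerGroup_le_mul_of_lemma91 h91 φ ψ (ψ.comp φ) hcomp

end BhargavaKlagsbrunLemkeOliverShnidman2019

end Literature.NumberTheory.EllipticCurves
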